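import Literature.AnabelianGeometry.EtaleTheta.Discharge.Sec4Thm44SelfEquivalenceOfConnectedTemperoid
import Literature.AnabelianGeometry.SemiGraphs.BTempCechToolkit

/-!
# [EtTh] §4 p.312 «`D := D₀[𝒟] (⊆ D₀)`» — the LAST §4-setting clause `hshape` of abc-iut-L2-t3's `Thm44Hyp` PRODUCED at the
# genuine base `B^temp(Π^tp_X)⁰` whenever the Def. 3.3 reference functor `D ⥤ D₀` is an equivalence (the §5 case «`α` is the identity»)

S. Mochizuki, *The étale theta function and its Frobenioid-theoretic manifestations*, Publ. RIMS **45** (2009)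
[MochizukiEtTh2009], §4 preamble p.312 (PDF p.86): «`C` … a tempered Frobenioid … whose base category `D` is of the form
`D := D₀[𝒟] (⊆ D₀)`»; §3 Ex. 3.9 p.311 (PDF p.85): «`D_α := (D_W)_B[α]` … `D_X` … special cases of `D_α`»; §5 p.322 (PDF p.96):
«Suppose further that the morphism `α : A → B` of Example 3.9, (iv), is the identity morphism» — so in §5 `D = D₀[A] = D₀` (every
connected tempered covering maps to the base curve, the one-point `Π^tp_X`-set).  [SemiAnbd] Rmk. 3.1.5 / Thm. A.4: the one-point
object of `B^temp(Π)` is terminal.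

abc-iut cell, layer L2, self-named follow-up of ROW R251 (seat abc-iut-w4-d008 gen 5), FILE 3.  PROOF-ONLY (no definition).
abc-iut-L2-t3's `Thm44Hyp.baseShape_i` reads print's clause as
`hshape : tf.base.Full ∧ tf.base.Faithful ∧ ∃ 𝒟 : D₀, ∀ Y : D₀, (∃ A : D, Nonempty (tf.base.obj A ≅ Y)) ↔ Nonempty (Y ⟶ 𝒟)`.
abc-iut-L2-t9's faithfulness record (`Sec5Prop51Thm44Pin` §5, p432820) showed that at the Example 3.9 (iv) presentation `D_α → D_W`
the clause "full" FAILS in general and that print «silently re-bases to `D₀ := B^temp(A^log)⁰ ≅ (D_W)_A`».  This file proves the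
clause for that re-based shape:
* `ConnectedPart.exists_weaklyTerminal_bTemp` — `B^temp(Π)⁰` has an object receiving a morphism from every object (the one-point
  `Π`-set, abc-iut's `BTemp.punitObj`, terminal in `B^temp(Π)` by `BTemp.isTerminal_punitObj`, and connected);
* `TemperedFrobenioid.baseShape_of_isEquivalence` — for ANY tempered Frobenioid whose reference functor `base : D ⥤ D₀` is an
  equivalence and any `D` with a weakly terminal object: `hshape` HOLDS (`𝒟 :=` the image of the weakly terminal object);
* `BiKummerSetting.hshape_mkOfConnectedTemperoid_of_isEquivalence` — the clause for abc-iut-L2-t4's settings over `B^temp(Π^tp_X)⁰`;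
* `BiKummerSetting.exists_thm44Hyp_self_of_base_isEquivalence` / `exists_thm44_self_of_base_isEquivalence` — the KNIT with FILES 1–2
  (p442771, p443466): for a tempered Frobenioid over `B^temp(Π^tp_X)⁰` whose reference functor is an equivalence and EVERY
  self-equivalence `Ψ`, abc-iut-L2-t3's `Thm44Hyp S S` with `hh.Ψ = Ψ` EXISTS and Thm. 4.4 (i) [(ii)(iii) given T44-L15b] hold with ALL
  FOUR §4-setting / 0-ary inputs {`hshape`, `hopen`, `hchar`, `h34`} DISCHARGED — residual {`hBinj` (Def. 3.3 (iii) datum), `hnd`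
  ("`Φ` non-dilating", Thm. 4.4's hypothesis on `C`), `hc : IsTopCharacteristic X.Pi H_⊙` ([EtTh] Prop. 2.4 clause)}.
HONEST FRAMING: kernel-checked category theory; implications for data so parametrised; nothing asserts that a tempered Frobenioid of
the curve with these properties has been constructed in the tree; [EtTh]/[SemiAnbd] are refereed pre-IUT material; nothing here bears
on [IUTchIII] Cor. 3.12 — no side is taken; typed ≠ proved — here PROVED modulo the displayed binders.
-/

noncomputable section

open CategoryTheory CategoryTheory.Limits

namespace Literature.AlgebraicGeometry.Frobenioids.ConnectedPart

open Literature.AnabelianGeometry.SemiGraphs Literature.AlgebraicGeometry.Frobenioids.QuasiTemperoid.BTempConnected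

universe u

variable {G : Type u} [Group G] [TopologicalSpace G]

/-- **`B^temp(Π)⁰` has a weakly terminal object**: the one-point `Π`-set (abc-iut's `BTemp.punitObj`, terminal in `B^temp(Π)`
— `BTemp.isTerminal_punitObj` —, and connected: one orbit) receives a morphism from every object of `B^temp(Π)⁰`; in print it is
the base curve itself, `𝒟 = X^log` (§5: «`α` is the identity»). [cite: MochizukiSemiAnbd2006, Rmk 3.1.5 p.34] -/
theorem exists_weaklyTerminal_bTemp : ∃ 𝒟 : ConnectedPart (BTemp G), ∀ Y : ConnectedPart (BTemp G), Nonempty (Y ⟶ 𝒟) :=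
  ⟨⟨BTemp.punitObj, isConnectedObj_of_transitive BTemp.punitObj PUnit.unit fun _ => ⟨1, rfl⟩⟩,
    fun Y => ⟨ObjectProperty.homMk (BTemp.isTerminal_punitObj.from Y.obj)⟩⟩

end Literature.AlgebraicGeometry.Frobenioids.ConnectedPart

namespace Literature.AnabelianGeometry.EtaleTheta

open Literature.AlgebraicGeometry.Frobenioids Literature.AnabelianGeometry.SemiGraphs

/-! ### `hshape` for a tempered Frobenioid whose reference functor is an equivalence -/

namespace TemperedFrobenioid

universe u₀ v₀ u v w

variable {D₀ : Type u₀} [Category.{v₀} D₀] {V : FrdIMonoidStub.{w}} {T : RealifiedDivisorMonoids (D₀ := D₀) V}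
  {D : Type u} [Category.{v} D] {VD : FrdICatStub.{u, v, w} D} (C : TemperedFrobenioid T D VD)

/-- **«`D := D₀[𝒟] (⊆ D₀)`» (the clause `Thm44Hyp.baseShape`) HOLDS when the Def. 3.3 reference functor `D ⥤ D₀` is an
equivalence of categories and `D` has a weakly terminal object `𝒟₀`** (`𝒟 := base(𝒟₀)`): an equivalence is full and faithful,
every `Y ∈ D₀` is `≅ base(A)` for `A := base⁻¹(Y)`, and `Y ≅ base(A) → base(𝒟₀)`. [cite: MochizukiEtTh2009, §4 p.312 (PDF p.86)] -/
theorem baseShape_of_isEquivalence [C.base.IsEquivalence] (h𝒟 : ∃ 𝒟₀ : D, ∀ A : D, Nonempty (A ⟶ 𝒟₀)) :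
    C.base.Full ∧ C.base.Faithful ∧
      ∃ 𝒟 : D₀, ∀ Y : D₀, (∃ A : D, Nonempty (C.base.obj A ≅ Y)) ↔ Nonempty (Y ⟶ 𝒟) := by
  obtain ⟨𝒟₀, h𝒟₀⟩ := h𝒟
  refine ⟨inferInstance, inferInstance, C.base.obj 𝒟₀, fun Y => ⟨?_, fun _ => ?_⟩⟩
  · rintro ⟨A, ⟨e⟩⟩
    obtain ⟨f⟩ := h𝒟₀ A
    exact ⟨e.inv ≫ C.base.map f⟩
  · exact ⟨C.base.inv.obj Y, ⟨(C.base.asEquivalence.counitIso.app Y)⟩⟩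

end TemperedFrobenioid

/-! ### The clause for abc-iut-L2-t4's settings over `B^temp(Π^tp_X)⁰`, and the knit -/

namespace BiKummerSetting

universe u₀ v₀ w

section Connected

variable {K : Type u₀} [Field K] (X : SemiGraphs.TemperedArithmeticGroup.{u₀} K) {D₀ : Type u₀} [Category.{v₀} D₀]
  {V : FrdIMonoidStub.{w}} {T₀ : RealifiedDivisorMonoids (D₀ := D₀) V}
  {VD : FrdICatStub.{u₀ + 1, u₀, w} (ConnectedPart (BTemp X.Pi))}
  (tf : TemperedFrobenioid T₀ (ConnectedPart (BTemp X.Pi)) VD)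

/-- **`hshape` over `B^temp(Π^tp_X)⁰`** for a tempered Frobenioid whose reference functor `B^temp(Π^tp_X)⁰ ⥤ D₀` is an equivalence
(§5: «`α` is the identity», `D = D₀`; `𝒟 :=` the image of the one-point `Π^tp_X`-set). [cite: MochizukiEtTh2009, §5 p.322 (PDF p.96)] -/
theorem hshape_of_base_isEquivalence [tf.base.IsEquivalence] :
    tf.base.Full ∧ tf.base.Faithful ∧
      ∃ 𝒟 : D₀, ∀ Y : D₀, (∃ A : ConnectedPart (BTemp X.Pi), Nonempty (tf.base.obj A ≅ Y)) ↔ Nonempty (Y ⟶ 𝒟) :=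
  tf.baseShape_of_isEquivalence ConnectedPart.exists_weaklyTerminal_bTemp

end Connected

section TreeVocab

variable {K : Type u₀} [Field K] (X : SemiGraphs.TemperedArithmeticGroup.{u₀} K) {D₀ : Type u₀} [Category.{v₀} D₀]
  {T₀ : RealifiedDivisorMonoids (D₀ := D₀) treeMonoidVocab.{w}}
  {IsRational IsStrictlyRational : ((ConnectedPart (BTemp X.Pi))ᵒᵖ ⥤ CommMonCat.{w}) → Prop}
  (C : TemperedFrobenioid T₀ (ConnectedPart (BTemp X.Pi)) (treeCatVocab (ConnectedPart (BTemp X.Pi)) IsRational IsStrictlyRational))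
  (hZ : C.monoidType = MonoidType.Z) (hP : ∀ A : (ConnectedPart (BTemp X.Pi))ᵒᵖ, IsPerfect (C.Φ.carrier A))
  (NH : Subgroup (Field.absoluteGaloisGroup K) → C.category → ℕ+ → Prop) (A₀ : C.category)
  (hA₀ : PreFrobenioid.IsFrobeniusTrivial C.toElem A₀) (hA₀' : SemiGraphs.IsGaloisObj A₀.base.obj)

/-- **Prop. 5.1's pin over the genuine base with ALL §4-setting clauses discharged**: for a tempered Frobenioid over `B^temp(Π^tp_X)⁰`
whose reference functor is an equivalence and EVERY self-equivalence `Ψ`, abc-iut-L2-t3's `Thm44Hyp S S` with `hh.Ψ = Ψ` EXISTS ⇐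
{`hBinj`, `hnd`, `hc : IsTopCharacteristic X.Pi H_⊙`} — `hshape` (this file), `hopen` (abc-iut-L2-t4), `hchar` (FILE 1), `h34`
(abc-iut-L1's `FrdI.Thm34ii_holds`) are theorems. [cite: MochizukiEtTh2009, Prop 5.1 p.323 (PDF p.97)] -/
theorem exists_thm44Hyp_self_of_base_isEquivalence [C.base.IsEquivalence]
    (hBinj : ∀ {Y Y' : D₀ᵒᵖ} (g : Y ⟶ Y'), Function.Injective (T₀.BΛ.map g).hom)
    (hnd : ∀ (A : (ConnectedPart (BTemp X.Pi))ᵒᵖ) (f : A ⟶ A), treeMonoidVocab.{w}.IsNonDilating (C.Φ.carrier A) (C.Φ.pull f))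
    (hc : IsTopCharacteristic X.Pi (mkOfConnectedTemperoid X C hZ hP NH A₀ hA₀ hA₀').Hodot) (Ψ : C.category ≌ C.category) :
    ∃ hh : Thm44Hyp (mkOfConnectedTemperoid X C hZ hP NH A₀ hA₀ hA₀') (mkOfConnectedTemperoid X C hZ hP NH A₀ hA₀ hA₀'),
      hh.Ψ = Ψ :=
  exists_thm44Hyp_self_of_hBinj X C hZ hP NH A₀ hA₀ hA₀' hBinj hnd (hshape_of_base_isEquivalence X C) hc Ψ

/-- **[EtTh] Thm. 4.4 for a self-equivalence `Ψ` over `B^temp(Π^tp_X)⁰` with reference functor an equivalence — ALL §4-setting clauses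
discharged**: the package `hh` (with `hh.Ψ = Ψ`) satisfies T44-L03, T44-L09, T44-L09c, T44-L08, Thm. 4.4 (i), and, given T44-L15b,
Thm. 4.4 (ii) (fraction-pairs), (iii) (saturation) and the `N`-th-roots clause (FILE 2's `exists_thm44_self_mkOfConnectedTemperoid`);
residual {`hBinj`, `hnd`, `hc`}. [cite: MochizukiEtTh2009, Thm 4.4 p.319–320 (PDF pp.93–94)] -/
theorem exists_thm44_self_of_base_isEquivalence [C.base.IsEquivalence]
    (hBinj : ∀ {Y Y' : D₀ᵒᵖ} (g : Y ⟶ Y'), Function.Injective (T₀.BΛ.map g).hom)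
    (hnd : ∀ (A : (ConnectedPart (BTemp X.Pi))ᵒᵖ) (f : A ⟶ A), treeMonoidVocab.{w}.IsNonDilating (C.Φ.carrier A) (C.Φ.pull f))
    (hc : IsTopCharacteristic X.Pi (mkOfConnectedTemperoid X C hZ hP NH A₀ hA₀ hA₀').Hodot) (Ψ : C.category ≌ C.category) :
    ∃ hh : Thm44Hyp (mkOfConnectedTemperoid X C hZ hP NH A₀ hA₀ hA₀') (mkOfConnectedTemperoid X C hZ hP NH A₀ hA₀ hA₀'),
      hh.Ψ = Ψ ∧ hh.PreservesFrobeniusStructure ∧ hh.HodotCompatible ∧ hh.GaloisCompatible ∧ hh.PreservesAmple ∧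
      Thm44_i hh ∧
      ∀ (hF₁ hF₂ : PreFrobenioid.IsFrobenioid C.toElem) (h3 : hh.PreservesFrobeniusStructure)
        (_ : hh.PreservesNHSaturatedBsFld),
        Thm44_ii hh (hh.psiModel hF₁ hF₂ h3) ∧ Thm44_iii hh (hh.psiModel hF₁ hF₂ h3) ∧
          hh.PreservesNthRoots (hh.psiModel hF₁ hF₂ h3) (fun φ f => C.pullFracModel φ f) (fun φ f => C.pullFracModel φ f) :=
  exists_thm44_self_mkOfConnectedTemperoid X C hZ hP NH A₀ hA₀ hA₀' hBinj hnd (hshape_of_base_isEquivalence X C) hc Ψ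

end TreeVocab

end BiKummerSetting

end Literature.AnabelianGeometry.EtaleTheta

end
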